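import Summits.Ventures.YMGap.FlowData.CircleKernelCharacterExpansion
import HarnessLib

/-!
# Venture YMGap, track Y3 FLOW-DATA — the SPECTRAL RESOLUTION of the circle transfer operator:
# `T ψ = Σ_n (c_n(β)/(n+1))^L ⟪φ_n, ψ⟫ φ_n`, `φ_n = χ_n ∘ hol` orthonormal, twist parity `(−1)^n` (theorems only)

HONEST FRAMING: venture file of the cell `pub-ymgap` (QuantumFields programme), track Y3; companion THEOREMS for
`FlowData/TorelonEnergy.lean` and `FlowData/TwoDimTorelonBound.lean` (file 3/4 of the d = 2 equality chain; file 4/4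
`FlowData/TwoDimTorelonEquality.lean` concludes `E₁((ℤ/L)¹; β) = L·(−ln u(β))`).  Slice dimension `k = 1` (theory
dimension two), `G = SU(2)`, fundamental representation, `J = β/2`, twist `−1` — the cell's ACTUAL typed objects.
NO Peter–Weyl: the circle slice kernel is expanded directly (`su2_sliceKernel_sliceOne_eq_tsum`, file 2/4) and the
series is integrated term by term against `L²` functions; completeness of the characters is never used.

* `orthonormal_holCharacter` — the holonomy characters `φ_n(b) = χ_n(b(0) b(ê₀) ⋯ b((L−1)ê₀))` are an orthonormal
  family in `L²(slice)` (integrate the link `(0, ê₀)` out by right invariance, `integral_pi_eq_integral_update`; Haar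
  orthonormality of `χ_n`);
* `fluxTwistOp_holCharacter` — twist parity `C_s φ_n = (−1)^{n·[s₀=1]} φ_n` (`χ_n(−X) = (−1)^n χ_n(X)`), hence
  `inner_holCharacter_eq_zero_of_odd`: on the odd sector `C_{ê₀}ψ = −ψ` the even characters are invisible;
* **`hasSum_tubeTransferOperator_sliceOne`** — for `β > 0` and every `ψ ∈ L²(slice)`,
  `tubeTransferOperator ρ (β/2) 1 L ψ = Σ_n (c_n(β)/(n+1))^L ⟪φ_n, ψ⟫ φ_n`, norm-convergent in `L²`
  (`Σ_n (c_n/(n+1))^L (n+1)² < ∞`, `summable_eigenvalue_sliceOne_mul_sq`; two dominated interchanges).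
Finite circles `(ℤ/L)¹` only; no number, no row, nothing about limits, `k ≥ 2` or a mass gap.

References: A. A. Migdal, Sov. Phys. JETP 42 (1975) 413; I. Montvay, G. Münster (1994) §3.2.6
[cite: MontvayMunster1994, §3.2.6]; G. 't Hooft, Nucl. Phys. B 153 (1979) 141 [cite: tHooft1979Flux].
-/

noncomputable section

open scoped BigOperators Topology
open MeasureTheory Filter Function Set Polynomial.Chebyshev
open Literature.MathematicalPhysics.QuantumFieldTheory Literature.MathematicalPhysics.QuantumLattice Literature.Analysis.FunctionSpaces
open Summit.Ventures.LatticeQCDFlow.Exactness Summit.Ventures.LatticeQCDFlow.Scoring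

namespace Summit.Ventures.YMGap.FlowData


/-! ### The holonomy characters of the circle: continuity, square integrability, orthonormality -/

section HolonomyCharacters

variable {L : ℕ} [NeZero L]

omit [NeZero L] in
/-- The holonomy character `b ↦ χ_n(b(0) b(ê₀) ⋯ b((L−1)ê₀))` is continuous. [folklore] -/
theorem continuous_holCharacter (n : ℕ) :
    Continuous fun b : GaugeConfig 1 L (Matrix.specialUnitaryGroup (Fin 2) ℂ) => (U ℝ n).eval (su2a0
      (List.ofFn fun t : Fin L => b (Pi.single (0 : Fin 1) ((t : ℕ) : ZMod L), (0 : Fin 1))).prod) :=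
  continuous_su2Character_comp n (continuous_prod_ofFn_apply L _)

omit [NeZero L] in
/-- `|χ_n(hol b)| ≤ n + 1`. [folklore] -/
theorem abs_holCharacter_le (n : ℕ) (b : GaugeConfig 1 L (Matrix.specialUnitaryGroup (Fin 2) ℂ)) :
    |(U ℝ n).eval (su2a0 (List.ofFn fun t : Fin L => b (Pi.single (0 : Fin 1) ((t : ℕ) : ZMod L), (0 : Fin 1))).prod)|
      ≤ (n : ℝ) + 1 :=
  abs_su2Character_le n _

/-- The holonomy character is square integrable on the slice. [folklore] -/
theorem memLp_holCharacter (n : ℕ) :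
    MemLp (fun b : GaugeConfig 1 L (Matrix.specialUnitaryGroup (Fin 2) ℂ) => (U ℝ n).eval (su2a0
      (List.ofFn fun t : Fin L => b (Pi.single (0 : Fin 1) ((t : ℕ) : ZMod L), (0 : Fin 1))).prod)) 2
      (sliceMeasure (Matrix.specialUnitaryGroup (Fin 2) ℂ) 1 L) := by
  haveI : SecondCountableTopology (Matrix.specialUnitaryGroup (Fin 2) ℂ) :=
    Summit.Ventures.LatticeQCDFlow.Scoring.secondCountableTopology_su2
  exact MemLp.of_bound (continuous_holCharacter n).aestronglyMeasurable ((n : ℝ) + 1)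
    (Eventually.of_forall fun b => by rw [Real.norm_eq_abs]; exact abs_holCharacter_le n b)

/-- **Haar orthonormality of the holonomy characters**: `∫ χ_m(hol b) χ_n(hol b) db = [m = n]` (integrate the link
`(0, ê₀)` out by right invariance; Haar orthonormality of the `χ_n`). [folklore] -/
theorem integral_holCharacter_mul_holCharacter (m n : ℕ) :
    ∫ b, (U ℝ m).eval (su2a0 (List.ofFn fun t : Fin L => b (Pi.single (0 : Fin 1) ((t : ℕ) : ZMod L), (0 : Fin 1))).prod) *
        (U ℝ n).eval (su2a0 (List.ofFn fun t : Fin L => b (Pi.single (0 : Fin 1) ((t : ℕ) : ZMod L), (0 : Fin 1))).prod)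
        ∂(sliceMeasure (Matrix.specialUnitaryGroup (Fin 2) ℂ) 1 L) = if m = n then 1 else 0 := by
  classical
  obtain ⟨L', rfl⟩ : ∃ L', L = L' + 1 := Nat.exists_eq_succ_of_ne_zero (NeZero.ne L)
  set ℓ : Fin (L' + 1) → Edge 1 (L' + 1) := fun t => (Pi.single (0 : Fin 1) ((t : ℕ) : ZMod (L' + 1)), (0 : Fin 1))
    with hℓ
  have hint : Integrable (fun b : GaugeConfig 1 (L' + 1) (Matrix.specialUnitaryGroup (Fin 2) ℂ) =>
      (U ℝ m).eval (su2a0 (List.ofFn fun t : Fin (L' + 1) => b (ℓ t)).prod) *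
        (U ℝ n).eval (su2a0 (List.ofFn fun t : Fin (L' + 1) => b (ℓ t)).prod))
      (sliceMeasure (Matrix.specialUnitaryGroup (Fin 2) ℂ) 1 (L' + 1)) :=
    integrable_pi_su2_of_continuous ((continuous_holCharacter m).mul (continuous_holCharacter n))
  change ∫ b, (U ℝ m).eval (su2a0 (List.ofFn fun t : Fin (L' + 1) => b (ℓ t)).prod) *
      (U ℝ n).eval (su2a0 (List.ofFn fun t : Fin (L' + 1) => b (ℓ t)).prod) ∂(sliceMeasure _ 1 (L' + 1)) = _
  rw [integral_pi_eq_integral_update _ (ℓ 0) hint]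
  -- the updated holonomy: `g · (rest)`
  have hne : ∀ t : Fin L', ℓ t.succ ≠ ℓ 0 := fun t h => Fin.succ_ne_zero t (line_injective (k := 1) 0 h)
  have hupd : ∀ (w : GaugeConfig 1 (L' + 1) (Matrix.specialUnitaryGroup (Fin 2) ℂ)) (g : Matrix.specialUnitaryGroup (Fin 2) ℂ),
      (List.ofFn fun t : Fin (L' + 1) => update w (ℓ 0) g (ℓ t)).prod =
        g * (List.ofFn fun t : Fin L' => w (ℓ t.succ)).prod := by
    intro w g
    have hfun : (fun t : Fin L' => update w (ℓ 0) g (ℓ t.succ)) = fun t => w (ℓ t.succ) :=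
      funext fun t => update_of_ne (hne t) _ _
    simp only [List.ofFn_succ, List.prod_cons, update_self, hfun]
  simp_rw [hupd]
  have hinner : ∀ w : GaugeConfig 1 (L' + 1) (Matrix.specialUnitaryGroup (Fin 2) ℂ),
      ∫ g, (U ℝ m).eval (su2a0 (g * (List.ofFn fun t : Fin L' => w (ℓ t.succ)).prod)) *
          (U ℝ n).eval (su2a0 (g * (List.ofFn fun t : Fin L' => w (ℓ t.succ)).prod))
          ∂haarProbability (Matrix.specialUnitaryGroup (Fin 2) ℂ) = if m = n then 1 else 0 := by
    intro w
    rw [integral_mul_right_eq_self (fun g : Matrix.specialUnitaryGroup (Fin 2) ℂ =>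
      (U ℝ m).eval (su2a0 g) * (U ℝ n).eval (su2a0 g)) _]
    exact integral_su2Character_mul_su2Character m n
  simp_rw [hinner]
  rw [integral_const, probReal_univ, one_smul]

/-- **The holonomy characters are an orthonormal family in `L²(slice)`.** [folklore] -/
theorem orthonormal_holCharacter :
    Orthonormal ℝ fun n : ℕ => (memLp_holCharacter (L := L) n).toLp _ := by
  classical
  rw [orthonormal_iff_ite]
  intro m n
  rw [MeasureTheory.L2.inner_def]
  rw [← integral_holCharacter_mul_holCharacter (L := L) m n]
  refine integral_congr_ae ?_
  filter_upwards [(memLp_holCharacter (L := L) m).coeFn_toLp, (memLp_holCharacter (L := L) n).coeFn_toLp]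
    with b hm hn
  rw [hm, hn]
  simp only [RCLike.inner_apply, conj_trivial, mul_comm]

end HolonomyCharacters

/-! ### Twist parity of the holonomy characters -/

section Parity

variable {L : ℕ} [NeZero L]

/-- `a₀(−X) = −a₀(X)`. [folklore] -/
theorem su2a0_su2MinusOne_mul (X : Matrix.specialUnitaryGroup (Fin 2) ℂ) :
    su2a0 (su2MinusOne * X) = -su2a0 X := by
  unfold su2a0
  rw [Submonoid.coe_mul, coe_su2MinusOne, neg_one_mul, Matrix.trace_neg, Complex.neg_re, neg_div]

/-- Parity of the characters: `χ_n(−t) = (−1)^n χ_n(t)`. [folklore] -/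
theorem chebyshevU_eval_neg_eq (n : ℕ) (x : ℝ) : (U ℝ n).eval (-x) = (-1 : ℝ) ^ n * (U ℝ n).eval x := by
  rw [U_eval_neg]
  norm_cast

/-- **Twist parity**: under the centre twist `s`, `χ_n(hol(twist_s b)) = (−1)^{n·[s₀ = 1]} χ_n(hol b)` (the line
picks up one factor `−1` iff its direction is twisted). [cite: tHooft1979Flux] -/
theorem holCharacter_fluxTwist (n : ℕ) (s : Fin 1 → ZMod 2) (b : GaugeConfig 1 L (Matrix.specialUnitaryGroup (Fin 2) ℂ)) :
    (U ℝ n).eval (su2a0 (List.ofFn fun t : Fin L =>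
        fluxTwist su2MinusOne s b (Pi.single (0 : Fin 1) ((t : ℕ) : ZMod L), (0 : Fin 1))).prod) =
      (if s 0 = 1 then (-1 : ℝ) ^ n else 1) *
        (U ℝ n).eval (su2a0 (List.ofFn fun t : Fin L => b (Pi.single (0 : Fin 1) ((t : ℕ) : ZMod L), (0 : Fin 1))).prod) := by
  rw [prod_ofFn_line_fluxTwist su2MinusOne s 0 b]
  by_cases hs : s 0 = 1
  · rw [if_pos hs, if_pos hs, su2a0_su2MinusOne_mul, chebyshevU_eval_neg_eq]
  · rw [if_neg hs, if_neg hs, one_mul, one_mul]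

/-- **The holonomy characters are joint twist eigenvectors**: `C_s φ_n = (−1)^{n·[s₀=1]} φ_n` in `L²(slice)`.
[cite: tHooft1979Flux] -/
theorem fluxTwistOp_holCharacter (n : ℕ) (s : Fin 1 → ZMod 2) :
    fluxTwistOp 1 L su2MinusOne s ((memLp_holCharacter (L := L) n).toLp _) =
      (if s 0 = 1 then (-1 : ℝ) ^ n else 1) • (memLp_holCharacter (L := L) n).toLp _ :=
  fluxTwistOp_toLp_eq_smul su2MinusOne s (memLp_holCharacter (L := L) n) _ fun b => holCharacter_fluxTwist n s b

/-- **On the odd sector the even characters are invisible**: for `ψ` with `C_{ê₀} ψ = −ψ` and `n` even,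
`⟪φ_n, ψ⟫ = 0`. [folklore] -/
theorem inner_holCharacter_eq_zero_of_odd {n : ℕ} (hn : Even n) {ψ : Lp ℝ 2 (sliceMeasure (Matrix.specialUnitaryGroup (Fin 2) ℂ) 1 L)}
    (hψ : fluxTwistOp 1 L su2MinusOne (Pi.single 0 1) ψ = -ψ) :
    @inner ℝ _ _ ((memLp_holCharacter (L := L) n).toLp _) ψ = 0 := by
  have hC := fluxTwistOp_holCharacter (L := L) n (Pi.single 0 1)
  rw [Pi.single_eq_same, if_pos rfl, hn.neg_one_pow, one_smul] at hC
  have hsa := (ContinuousLinearMap.isSelfAdjoint_iff_isSymmetric.1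
    (isSelfAdjoint_fluxTwistOp (k := 1) (L := L) su2MinusOne su2MinusOne_mul_self (Pi.single 0 1)))
    ((memLp_holCharacter (L := L) n).toLp _) ψ
  change @inner ℝ _ _ (fluxTwistOp 1 L su2MinusOne (Pi.single 0 1) ((memLp_holCharacter (L := L) n).toLp _)) ψ =
    @inner ℝ _ _ ((memLp_holCharacter (L := L) n).toLp _) (fluxTwistOp 1 L su2MinusOne (Pi.single 0 1) ψ) at hsa
  rw [hC, hψ, inner_neg_right] at hsa
  linarith

end Parity

/-! ### The spectral resolution of the circle transfer operator -/

section Resolution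

open Literature.MathematicalPhysics.QuantumLattice (fundamentalRep continuous_fundamentalRep)

variable {L : ℕ} [NeZero L]

omit [NeZero L] in
/-- The eigenvalue list `(c_n(β)/(n+1))^L` is non-negative. [folklore] -/
theorem eigenvalue_sliceOne_nonneg {β : ℝ} (hβ : 0 ≤ β) (n : ℕ) :
    0 ≤ ((besselI n β - besselI (n + 2) β) / (n + 1)) ^ L :=
  pow_nonneg (div_nonneg (besselISub_nonneg hβ n) (by positivity)) L

/-- **Summability of the eigenvalue list against `(n+1)²`**: `Σ_n (c_n/(n+1))^L (n+1)² < ∞` (`β > 0`, `L ≥ 1`).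
[folklore] -/
theorem summable_eigenvalue_sliceOne_mul_sq {β : ℝ} (hβ : 0 < β) :
    Summable fun n : ℕ => ((besselI n β - besselI (n + 2) β) / (n + 1)) ^ L * ((n : ℝ) + 1) ^ 2 := by
  obtain ⟨L', hL⟩ : ∃ L', L = L' + 1 := Nat.exists_eq_succ_of_ne_zero (NeZero.ne L)
  have h0 : ∀ n : ℕ, 0 ≤ (besselI n β - besselI (n + 2) β) / (n + 1) := fun n =>
    div_nonneg (besselISub_nonneg hβ.le n) (by positivity)
  have htop : ∀ n : ℕ, (besselI n β - besselI (n + 2) β) / (n + 1) ≤ (besselI 0 β - besselI (0 + 2) β) / (0 + 1) := by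
    intro n
    have h := besselISub_div_succ_antitone hβ (Nat.zero_le n)
    simpa using h
  refine Summable.of_nonneg_of_le (fun n => mul_nonneg (pow_nonneg (h0 n) L) (sq_nonneg _)) (fun n => ?_)
    ((summable_succ_mul_besselISub hβ.le).mul_left (((besselI 0 β - besselI (0 + 2) β) / (0 + 1)) ^ L'))
  rw [hL, pow_succ]
  have hn : (0 : ℝ) < (n : ℝ) + 1 := by positivity
  calc ((besselI n β - besselI (n + 2) β) / (n + 1)) ^ L' * ((besselI n β - besselI (n + 2) β) / (n + 1)) *
        ((n : ℝ) + 1) ^ 2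
      ≤ ((besselI 0 β - besselI (0 + 2) β) / (0 + 1)) ^ L' * ((besselI n β - besselI (n + 2) β) / (n + 1)) *
        ((n : ℝ) + 1) ^ 2 :=
        mul_le_mul_of_nonneg_right (mul_le_mul_of_nonneg_right (pow_le_pow_left₀ (h0 n) (htop n) L') (h0 n))
          (sq_nonneg _)
    _ = ((besselI 0 β - besselI (0 + 2) β) / (0 + 1)) ^ L' * (((n : ℝ) + 1) * (besselI n β - besselI (n + 2) β)) := by
        field_simp

/-- `Σ_n (c_n/(n+1))^L < ∞`. [folklore] -/
theorem summable_eigenvalue_sliceOne {β : ℝ} (hβ : 0 < β) :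
    Summable fun n : ℕ => ((besselI n β - besselI (n + 2) β) / (n + 1)) ^ L :=
  Summable.of_nonneg_of_le (eigenvalue_sliceOne_nonneg hβ.le) (fun n => by
    have h1 : (1 : ℝ) ≤ ((n : ℝ) + 1) ^ 2 := one_le_pow₀ (by linarith [n.cast_nonneg (α := ℝ)])
    exact le_mul_of_one_le_right (eigenvalue_sliceOne_nonneg hβ.le n) h1) (summable_eigenvalue_sliceOne_mul_sq hβ)

/-- `L²` functions on the slice are integrable (probability space). [folklore] -/
theorem integrable_of_Lp_sliceMeasure (ψ : Lp ℝ 2 (sliceMeasure (Matrix.specialUnitaryGroup (Fin 2) ℂ) 1 L)) :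
    Integrable (ψ : GaugeConfig 1 L (Matrix.specialUnitaryGroup (Fin 2) ℂ) → ℝ)
      (sliceMeasure (Matrix.specialUnitaryGroup (Fin 2) ℂ) 1 L) :=
  (Lp.memLp ψ).integrable one_le_two

/-- **Integrating the kernel series against an `L²` function term by term** (one variable):
`∫ (Σ_n λ_n φ_n(a) φ_n(b)) ψ(b) db = Σ_n λ_n φ_n(a) ∫ φ_n ψ`. [folklore] -/
theorem integral_kernelSeries_mul {β : ℝ} (hβ : 0 < β) (a : GaugeConfig 1 L (Matrix.specialUnitaryGroup (Fin 2) ℂ))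
    (ψ : Lp ℝ 2 (sliceMeasure (Matrix.specialUnitaryGroup (Fin 2) ℂ) 1 L)) :
    ∫ b, (∑' n : ℕ, ((besselI n β - besselI (n + 2) β) / (n + 1)) ^ L *
        ((U ℝ n).eval (su2a0 (List.ofFn fun t : Fin L => a (Pi.single (0 : Fin 1) ((t : ℕ) : ZMod L), (0 : Fin 1))).prod) *
          (U ℝ n).eval (su2a0 (List.ofFn fun t : Fin L => b (Pi.single (0 : Fin 1) ((t : ℕ) : ZMod L), (0 : Fin 1))).prod))) *
        ψ b ∂(sliceMeasure (Matrix.specialUnitaryGroup (Fin 2) ℂ) 1 L) =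
      ∑' n : ℕ, ((besselI n β - besselI (n + 2) β) / (n + 1)) ^ L *
        (U ℝ n).eval (su2a0 (List.ofFn fun t : Fin L => a (Pi.single (0 : Fin 1) ((t : ℕ) : ZMod L), (0 : Fin 1))).prod) *
        ∫ b, (U ℝ n).eval (su2a0 (List.ofFn fun t : Fin L => b (Pi.single (0 : Fin 1) ((t : ℕ) : ZMod L), (0 : Fin 1))).prod) *
          ψ b ∂(sliceMeasure (Matrix.specialUnitaryGroup (Fin 2) ℂ) 1 L) := by
  haveI : SecondCountableTopology (Matrix.specialUnitaryGroup (Fin 2) ℂ) :=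
    Summit.Ventures.LatticeQCDFlow.Scoring.secondCountableTopology_su2
  set φf : ℕ → GaugeConfig 1 L (Matrix.specialUnitaryGroup (Fin 2) ℂ) → ℝ := fun n b =>
    (U ℝ n).eval (su2a0 (List.ofFn fun t : Fin L => b (Pi.single (0 : Fin 1) ((t : ℕ) : ZMod L), (0 : Fin 1))).prod)
    with hφf
  set ev : ℕ → ℝ := fun n => ((besselI n β - besselI (n + 2) β) / (n + 1)) ^ L with hev
  have hψ := integrable_of_Lp_sliceMeasure ψ
  -- termwise integrability and the summable norm bound
  have hFint : ∀ n, Integrable (fun b => ev n * (φf n a * φf n b) * ψ b)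
      (sliceMeasure (Matrix.specialUnitaryGroup (Fin 2) ℂ) 1 L) := by
    intro n
    have h := Integrable.bdd_mul (f := fun b => ev n * (φf n a * φf n b)) (c := ev n * (((n : ℝ) + 1) * ((n : ℝ) + 1)))
      hψ ((continuous_const.mul (continuous_const.mul (continuous_holCharacter n))).aestronglyMeasurable)
      (Eventually.of_forall fun b => by
        rw [Real.norm_eq_abs, abs_mul, abs_mul, abs_of_nonneg (eigenvalue_sliceOne_nonneg hβ.le n)]
        exact mul_le_mul_of_nonneg_left (mul_le_mul (abs_holCharacter_le n a) (abs_holCharacter_le n b)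
          (abs_nonneg _) (by positivity)) (eigenvalue_sliceOne_nonneg hβ.le n))
    exact h
  have hFsum : Summable fun n : ℕ => ∫ b, ‖ev n * (φf n a * φf n b) * ψ b‖
      ∂(sliceMeasure (Matrix.specialUnitaryGroup (Fin 2) ℂ) 1 L) := by
    refine Summable.of_nonneg_of_le (fun n => integral_nonneg fun b => norm_nonneg _) (fun n => ?_)
      ((summable_eigenvalue_sliceOne_mul_sq (L := L) hβ).mul_right
        (∫ b, |ψ b| ∂(sliceMeasure (Matrix.specialUnitaryGroup (Fin 2) ℂ) 1 L)))
    rw [← integral_const_mul]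
    refine integral_mono_of_nonneg (Eventually.of_forall fun b => norm_nonneg _) (hψ.abs.const_mul _)
      (Eventually.of_forall fun b => ?_)
    dsimp only
    rw [Real.norm_eq_abs, abs_mul, abs_mul, abs_mul, abs_of_nonneg (eigenvalue_sliceOne_nonneg hβ.le n)]
    have h1 := abs_holCharacter_le (L := L) n a
    have h2 := abs_holCharacter_le (L := L) n b
    have h3 : |φf n a| * |φf n b| ≤ ((n : ℝ) + 1) ^ 2 := by
      rw [sq]; exact mul_le_mul h1 h2 (abs_nonneg _) (by positivity)
    calc ev n * (|φf n a| * |φf n b|) * |ψ b| ≤ ev n * ((n : ℝ) + 1) ^ 2 * |ψ b| :=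
          mul_le_mul_of_nonneg_right (mul_le_mul_of_nonneg_left h3 (eigenvalue_sliceOne_nonneg hβ.le n)) (abs_nonneg _)
      _ = ev n * ((n : ℝ) + 1) ^ 2 * |ψ b| := rfl
  have h := integral_tsum_of_summable_integral_norm hFint hFsum
  -- assemble
  have hlhs : ∀ b, (∑' n : ℕ, ev n * (φf n a * φf n b)) * ψ b = ∑' n : ℕ, ev n * (φf n a * φf n b) * ψ b :=
    fun b => (tsum_mul_right).symm
  simp only [hφf, hev] at hlhs h ⊢
  simp_rw [hlhs, ← h]
  refine tsum_congr fun n => ?_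
  rw [← integral_const_mul]
  refine integral_congr_ae (Eventually.of_forall fun b => ?_)
  ring

/-- **THE SPECTRAL RESOLUTION OF THE CIRCLE TRANSFER OPERATOR**: for the SU(2) tube transfer operator on the circle
`(ℤ/L)¹` at `β > 0`, and every `ψ ∈ L²(slice)`,
`T ψ = Σ_n (c_n(β)/(n+1))^L ⟪φ_n, ψ⟫ φ_n` (norm-convergent in `L²`), `φ_n = χ_n ∘ hol` the holonomy characters.
[cite: MontvayMunster1994, §3.2.6] -/
theorem hasSum_tubeTransferOperator_sliceOne {β : ℝ} (hβ : 0 < β)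
    (ψ : Lp ℝ 2 (sliceMeasure (Matrix.specialUnitaryGroup (Fin 2) ℂ) 1 L)) :
    HasSum (fun n : ℕ => (((besselI n β - besselI (n + 2) β) / (n + 1)) ^ L *
        @inner ℝ _ _ ((memLp_holCharacter (L := L) n).toLp _) ψ) • (memLp_holCharacter (L := L) n).toLp _)
      (tubeTransferOperator (fundamentalRep (Fin 2)) (β / 2) 1 L ψ) := by
  haveI : SecondCountableTopology (Matrix.specialUnitaryGroup (Fin 2) ℂ) :=
    Summit.Ventures.LatticeQCDFlow.Scoring.secondCountableTopology_su2
  set φf : ℕ → GaugeConfig 1 L (Matrix.specialUnitaryGroup (Fin 2) ℂ) → ℝ := fun n b =>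
    (U ℝ n).eval (su2a0 (List.ofFn fun t : Fin L => b (Pi.single (0 : Fin 1) ((t : ℕ) : ZMod L), (0 : Fin 1))).prod)
    with hφf
  set ev : ℕ → ℝ := fun n => ((besselI n β - besselI (n + 2) β) / (n + 1)) ^ L with hev
  set Φ : ℕ → Lp ℝ 2 (sliceMeasure (Matrix.specialUnitaryGroup (Fin 2) ℂ) 1 L) := fun n =>
    (memLp_holCharacter (L := L) n).toLp _ with hΦ
  have hΦae : ∀ n, ((Φ n : Lp ℝ 2 (sliceMeasure (Matrix.specialUnitaryGroup (Fin 2) ℂ) 1 L)) :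
      GaugeConfig 1 L (Matrix.specialUnitaryGroup (Fin 2) ℂ) → ℝ) =ᵐ[sliceMeasure (Matrix.specialUnitaryGroup (Fin 2) ℂ) 1 L]
      φf n := fun n => (memLp_holCharacter (L := L) n).coeFn_toLp
  have hnormΦ : ∀ n, ‖Φ n‖ = 1 := (orthonormal_holCharacter (L := L)).1
  -- inner products as integrals
  have hinner : ∀ (n : ℕ) (η : Lp ℝ 2 (sliceMeasure (Matrix.specialUnitaryGroup (Fin 2) ℂ) 1 L)),
      @inner ℝ _ _ (Φ n) η = ∫ b, φf n b * η b ∂(sliceMeasure (Matrix.specialUnitaryGroup (Fin 2) ℂ) 1 L) := by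
    intro n η
    rw [MeasureTheory.L2.inner_def]
    refine integral_congr_ae ?_
    filter_upwards [hΦae n] with b hb
    rw [hb]
    simp only [RCLike.inner_apply, conj_trivial, mul_comm]
  have hinner' : ∀ (n : ℕ) (η : Lp ℝ 2 (sliceMeasure (Matrix.specialUnitaryGroup (Fin 2) ℂ) 1 L)),
      @inner ℝ _ _ η (Φ n) = ∫ b, η b * φf n b ∂(sliceMeasure (Matrix.specialUnitaryGroup (Fin 2) ℂ) 1 L) := by
    intro n η
    rw [real_inner_comm, hinner]
    simp_rw [mul_comm]
  -- summability of the expansion in `L²`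
  have hsum : Summable fun n : ℕ => (ev n * @inner ℝ _ _ (Φ n) ψ) • Φ n := by
    refine Summable.of_norm (Summable.of_nonneg_of_le (fun n => norm_nonneg _) (fun n => ?_)
      ((summable_eigenvalue_sliceOne (L := L) hβ).mul_right ‖ψ‖))
    rw [norm_smul, hnormΦ, mul_one, Real.norm_eq_abs, abs_mul, abs_of_nonneg (eigenvalue_sliceOne_nonneg hβ.le n)]
    refine mul_le_mul_of_nonneg_left ?_ (eigenvalue_sliceOne_nonneg hβ.le n)
    have h := abs_real_inner_le_norm (Φ n) ψ
    rwa [hnormΦ, one_mul] at h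
  have hS := hsum.hasSum
  suffices heq : (∑' n : ℕ, (ev n * @inner ℝ _ _ (Φ n) ψ) • Φ n) =
      tubeTransferOperator (fundamentalRep (Fin 2)) (β / 2) 1 L ψ by
    rw [heq] at hS; exact hS
  refine ext_inner_left ℝ fun η => ?_
  -- left: the series of inner products
  have hleft : @inner ℝ _ _ η (∑' n : ℕ, (ev n * @inner ℝ _ _ (Φ n) ψ) • Φ n) =
      ∑' n : ℕ, ev n * @inner ℝ _ _ (Φ n) ψ * @inner ℝ _ _ η (Φ n) := by
    have h := (hS.mapL (innerSL ℝ η)).tsum_eq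
    simp only [innerSL_apply_apply, real_inner_smul_right] at h
    rw [← h]
  rw [hleft, inner_tubeTransferOperator_eq_integral (β / 2) 1 L (continuous_fundamentalRep (Fin 2)) η ψ]
  -- right: the kernel series, integrated term by term twice
  have hK : ∀ a b : GaugeConfig 1 L (Matrix.specialUnitaryGroup (Fin 2) ℂ),
      sliceKernel (d := 1) (L := L) (fundamentalRep (Fin 2)) (β / 2) (β / 2) a b =
        ∑' n : ℕ, ev n * (φf n a * φf n b) := fun a b => su2_sliceKernel_sliceOne_eq_tsum hβ.le a b
  simp_rw [hK]
  have hin : ∀ a : GaugeConfig 1 L (Matrix.specialUnitaryGroup (Fin 2) ℂ),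
      ∫ b, (∑' n : ℕ, ev n * (φf n a * φf n b)) * ψ b ∂(sliceMeasure (Matrix.specialUnitaryGroup (Fin 2) ℂ) 1 L) =
        ∑' n : ℕ, ev n * φf n a * @inner ℝ _ _ (Φ n) ψ := by
    intro a
    rw [integral_kernelSeries_mul hβ a ψ]
    simp_rw [hinner]
    simp only [hφf, hev]
  simp_rw [hin]
  -- the outer interchange
  have hη := integrable_of_Lp_sliceMeasure η
  have hψ1 : ∀ n, |@inner ℝ _ _ (Φ n) ψ| ≤ ‖ψ‖ := fun n => by
    have h := abs_real_inner_le_norm (Φ n) ψ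
    rwa [hnormΦ, one_mul] at h
  have hGint : ∀ n, Integrable (fun a => η a * (ev n * φf n a * @inner ℝ _ _ (Φ n) ψ))
      (sliceMeasure (Matrix.specialUnitaryGroup (Fin 2) ℂ) 1 L) := by
    intro n
    have h := Integrable.mul_bdd (g := fun a => ev n * φf n a * @inner ℝ _ _ (Φ n) ψ) (c := ev n * ((n : ℝ) + 1) * ‖ψ‖)
      hη (((continuous_const.mul (continuous_holCharacter n)).mul continuous_const).aestronglyMeasurable)
      (Eventually.of_forall fun a => by
        rw [Real.norm_eq_abs, abs_mul, abs_mul, abs_of_nonneg (eigenvalue_sliceOne_nonneg hβ.le n)]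
        exact mul_le_mul (mul_le_mul_of_nonneg_left (abs_holCharacter_le n a) (eigenvalue_sliceOne_nonneg hβ.le n))
          (hψ1 n) (abs_nonneg _) (mul_nonneg (eigenvalue_sliceOne_nonneg hβ.le n) (by positivity)))
    exact h
  have hGsum : Summable fun n : ℕ => ∫ a, ‖η a * (ev n * φf n a * @inner ℝ _ _ (Φ n) ψ)‖
      ∂(sliceMeasure (Matrix.specialUnitaryGroup (Fin 2) ℂ) 1 L) := by
    refine Summable.of_nonneg_of_le (fun n => integral_nonneg fun b => norm_nonneg _) (fun n => ?_)
      (((summable_eigenvalue_sliceOne_mul_sq (L := L) hβ).mul_right ‖ψ‖).mul_right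
        (∫ a, |η a| ∂(sliceMeasure (Matrix.specialUnitaryGroup (Fin 2) ℂ) 1 L)))
    rw [← integral_const_mul]
    refine integral_mono_of_nonneg (Eventually.of_forall fun b => norm_nonneg _) (hη.abs.const_mul _)
      (Eventually.of_forall fun a => ?_)
    dsimp only
    rw [Real.norm_eq_abs, abs_mul, abs_mul, abs_mul, abs_of_nonneg (eigenvalue_sliceOne_nonneg hβ.le n)]
    have h1 := abs_holCharacter_le (L := L) n a
    have h2 : ev n * |φf n a| * |@inner ℝ _ _ (Φ n) ψ| ≤ ev n * ((n : ℝ) + 1) ^ 2 * ‖ψ‖ := by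
      have h4 : |φf n a| ≤ ((n : ℝ) + 1) ^ 2 := h1.trans (by nlinarith [n.cast_nonneg (α := ℝ)])
      exact mul_le_mul (mul_le_mul_of_nonneg_left h4 (eigenvalue_sliceOne_nonneg hβ.le n)) (hψ1 n) (abs_nonneg _)
        (mul_nonneg (eigenvalue_sliceOne_nonneg hβ.le n) (by positivity))
    calc |η a| * (ev n * |φf n a| * |@inner ℝ _ _ (Φ n) ψ|) ≤ |η a| * (ev n * ((n : ℝ) + 1) ^ 2 * ‖ψ‖) :=
          mul_le_mul_of_nonneg_left h2 (abs_nonneg _)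
      _ = ev n * ((n : ℝ) + 1) ^ 2 * ‖ψ‖ * |η a| := by ring
  have hG := integral_tsum_of_summable_integral_norm hGint hGsum
  have hrhs : ∀ a, η a * (∑' n : ℕ, ev n * φf n a * @inner ℝ _ _ (Φ n) ψ) =
      ∑' n : ℕ, η a * (ev n * φf n a * @inner ℝ _ _ (Φ n) ψ) := fun a => (tsum_mul_left).symm
  simp_rw [hrhs, ← hG]
  refine tsum_congr fun n => ?_
  rw [hinner' n η, ← integral_const_mul]
  refine integral_congr_ae (Eventually.of_forall fun a => ?_)
  ring

end Resolution

end Summit.Ventures.YMGap.FlowData
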